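import Literature.NumberTheory.Automorphic.UnitaryGroupRankOneRaySquare         -- ★ p834010: `exists_sq_eq_admissible_mul_unit` (the square of the twisted ray)
import Literature.NumberTheory.Automorphic.CMLocalNonsplitBorelTransport        -- ★ p833070 (B-p04): `localNonsplitEquiv_mem_torusU_iff`, `mem_range_glDiagonal_iff_isDiag`
import Literature.NumberTheory.Automorphic.DoubleCosetShellVolumeBound          -- ★ R3d (B-p04): `DoubleCosetIndex.measure_image_doubleCoset_pow_le_ofReal`
import Literature.NumberTheory.Automorphic.CMBorelUnipotentIndexModulus         -- ★ R3e (B-p04): `map_torusConj_pow_inv_cmBorel`, `coe_torusConj_pow_inv`, `isClosed_cmBorelTriple_N`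
import HarnessLib

/-!
# Three inputs of Casselman's criterion on the CM carrier `U(Φ₃)(L⁺_v)`: the closed torus, the UPPER shell bound at an Iwahori datum, and
# the square of the uniformiser ray (Casselman 1995, Prop. 1.4.4, Lemma 1.5.1, Thm. 4.4.6)

Topic `NumberTheory/Automorphic`; namespace `Literature.NumberTheory.Automorphic.UnitaryGroup`.  THEOREMS ONLY (no definition, no named fact, no
instance, no notation, no `sorry`).  Cell `hodgecm-mathlib`, F0∕P3, N5 road (★ `UnitaryGroup.U3SquareIntegrableExponents` [Casselman1995, Thm. 4.4.6],
books letter #109), seat F0P3-p01 (g10), road lead: the three CM-carrier inputs of the «⇐» assembly (R6 ED. 2,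
`Summits/…/Theorems/F0P3U3SquareIntegrableExponentsHolds.lean`) that are not representation theory:
* `isClosed_cmBorelTriple_M` — the diagonal torus `T` of ★ `cmBorelTriple L 3 v` is closed (so `T ∩ K₀` is compact for a compact `K₀`);
* `measure_image_shell_le_cmIwahoriDatum` — `μZ((K₀ aᵐ K₀)Z∕Z) ≤ [K₀ : K] · μZ(K₀Z∕Z) · (Δ_B a)⁻ᵐ` for an Iwahori datum `𝓘` of ★ `cmBorelTriple L 3 v`
  with level `K = 𝓘.K 0 ≤ K₀`, `Z ≤ K₀` compact open, `a = 𝓘.a` dominant, unique `N`-components (★ `DoubleCosetIndex.measure_image_doubleCoset_pow_le_ofReal`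
  with the radical's Haar scaling ★ `map_torusConj_pow_inv_cmBorel`) — the `hvol` binder of ★
  `Representation.isSquareIntegrableModCenter_of_forall_norm_exponent_lt_one_of_sq`;
* `exists_sq_eq_mul_of_coe_localNonsplitEquiv_eq_diagonal` — for the uniformiser ray `e a = d(ϖ, 1, (σ_w ϖ)⁻¹)` of the one-place model,
  `a² = b · k` in `T(L⁺_v)` with `e b = d(ϖσ_wϖ, 1, (σ_w(ϖσ_wϖ))⁻¹)` (admissible: `ϖ σ_w ϖ` is `σ_w`-fixed) and `e k ∈ GL₃(𝒪_w)` (★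
  `exists_sq_eq_admissible_mul_unit` pulled back along ★ `localNonsplitEquiv`; the RAMIFIED quadratic case included).
HC_CM is proved only modulo the printed citations until rung 0 closes; count-neutral.

## References
* [Casselman1995] W. Casselman, *Introduction to the theory of admissible representations of `p`-adic reductive groups* (draft 1 May 1995),
  Prop. 1.4.4 p. 14, §1.5 Lemma 1.5.1 p. 16, Thm. 4.4.6 p. 45.
* [Rogawski1990] J. D. Rogawski, *Automorphic Representations of Unitary Groups in Three Variables* (1990), §1.10 p. 9, §12.2 (2) p. 174.
* [PlatonovRapinchuk1994] V. Platonov, A. Rapinchuk, *Algebraic Groups and Number Theory* (1994), §5.1.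
-/

set_option autoImplicit false

noncomputable section

open MeasureTheory Measure
open scoped NNReal ENNReal Pointwise MatrixGroups

namespace Literature.NumberTheory.Automorphic

namespace UnitaryGroup

open _root_.NumberField _root_.IsDedekindDomain

variable (L : Type) [Field L] [NumberField L] [IsCMField L]

variable (v : HeightOneSpectrum (𝓞 ↥(maximalRealSubfield L)))

/-- **The diagonal torus `T = M` of ★ `cmBorelTriple L 3 v` is closed in `U(Φ₃)(L⁺_v)`** (the vanishing of the six continuous off-diagonal entries;
★ `mem_range_glDiagonal_iff_isDiag`). [cite: Rogawski1990, §1.10 p. 9] -/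
theorem isClosed_cmBorelTriple_M :
    IsClosed (((cmBorelTriple L 3 v).M : Subgroup ↥(unitaryGroupOfForm (conjLocal L (IsCMField.complexConj L) v) (cmLocalForm L 3 v))) :
      Set ↥(unitaryGroupOfForm (conjLocal L (IsCMField.complexConj L) v) (cmLocalForm L 3 v))) := by
  have hcont : ∀ i j : Fin 3, Continuous fun g : ↥(unitaryGroupOfForm (conjLocal L (IsCMField.complexConj L) v) (cmLocalForm L 3 v)) =>
      (g : GL (Fin 3) (UnitaryGroup.LocalRing L v)) i j := fun i j =>
    ((Units.continuous_val.comp continuous_subtype_val).matrix_elem i j)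
  have hset : (((cmBorelTriple L 3 v).M : Subgroup ↥(unitaryGroupOfForm (conjLocal L (IsCMField.complexConj L) v) (cmLocalForm L 3 v))) :
      Set ↥(unitaryGroupOfForm (conjLocal L (IsCMField.complexConj L) v) (cmLocalForm L 3 v))) =
      ⋂ i : Fin 3, ⋂ j : Fin 3, {g : ↥(unitaryGroupOfForm (conjLocal L (IsCMField.complexConj L) v) (cmLocalForm L 3 v)) |
        i ≠ j → (g : GL (Fin 3) (UnitaryGroup.LocalRing L v)) i j = 0} := by
    ext g
    simp only [Set.mem_iInter, Set.mem_setOf_eq, SetLike.mem_coe]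
    exact (mem_range_glDiagonal_iff_isDiag (g : GL (Fin 3) (UnitaryGroup.LocalRing L v))).trans
      ⟨fun h i j hij => h hij, fun h i j hij => h i j hij⟩
  rw [hset]
  refine isClosed_iInter fun i => isClosed_iInter fun j => ?_
  by_cases hij : i ≠ j
  · have : {g : ↥(unitaryGroupOfForm (conjLocal L (IsCMField.complexConj L) v) (cmLocalForm L 3 v)) |
        i ≠ j → (g : GL (Fin 3) (UnitaryGroup.LocalRing L v)) i j = 0} =
        (fun g : ↥(unitaryGroupOfForm (conjLocal L (IsCMField.complexConj L) v) (cmLocalForm L 3 v)) =>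
          (g : GL (Fin 3) (UnitaryGroup.LocalRing L v)) i j) ⁻¹' {0} := by
      ext g; simp [hij]
    rw [this]
    exact isClosed_singleton.preimage (hcont i j)
  · have : {g : ↥(unitaryGroupOfForm (conjLocal L (IsCMField.complexConj L) v) (cmLocalForm L 3 v)) |
        i ≠ j → (g : GL (Fin 3) (UnitaryGroup.LocalRing L v)) i j = 0} = Set.univ := by
      ext g; simp [hij]
    rw [this]
    exact isClosed_univ

/-- **The UPPER shell bound at a CM Iwahori datum** (the `hvol` binder of ★ `Representation.isSquareIntegrableModCenter_of_forall_norm_exponent_lt_one_of_sq`):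
for an Iwahori datum `𝓘` of ★ `cmBorelTriple L 3 v` whose level `K = 𝓘.K 0` sits in a compact open `K₀ ⊇ Z(G)` with `a = 𝓘.a` dominant
(`a(K ∩ N)a⁻¹ ⊆ K`, `a⁻¹(K ∩ N̄)a ⊆ K ∩ N̄`) and unique `N`-components, `μZ((K₀ aᵐ K₀)Z∕Z) ≤ [K₀ : K] · μZ(K₀Z∕Z) · (Δ_B(a)⁻¹)ᵐ` — ★
`DoubleCosetIndex.measure_image_doubleCoset_pow_le_ofReal` with the radical's Haar scaling ★ `map_torusConj_pow_inv_cmBorel`.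
[cite: Casselman1995, Prop. 1.4.4 p. 14, §1.5 Lemma 1.5.1 p. 16, Thm. 4.4.6 p. 45] -/
theorem measure_image_shell_le_cmIwahoriDatum
    [MeasurableSpace (↥(unitaryGroupOfForm (conjLocal L (IsCMField.complexConj L) v) (cmLocalForm L 3 v)) ⧸
      Subgroup.center ↥(unitaryGroupOfForm (conjLocal L (IsCMField.complexConj L) v) (cmLocalForm L 3 v)))]
    [BorelSpace (↥(unitaryGroupOfForm (conjLocal L (IsCMField.complexConj L) v) (cmLocalForm L 3 v)) ⧸
      Subgroup.center ↥(unitaryGroupOfForm (conjLocal L (IsCMField.complexConj L) v) (cmLocalForm L 3 v)))]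
    (μZ : Measure (↥(unitaryGroupOfForm (conjLocal L (IsCMField.complexConj L) v) (cmLocalForm L 3 v)) ⧸
      Subgroup.center ↥(unitaryGroupOfForm (conjLocal L (IsCMField.complexConj L) v) (cmLocalForm L 3 v)))) [μZ.IsHaarMeasure]
    (𝓘 : (cmBorelTriple L 3 v).IwahoriDatum)
    (K₀ : Subgroup ↥(unitaryGroupOfForm (conjLocal L (IsCMField.complexConj L) v) (cmLocalForm L 3 v)))
    (hK₀c : IsCompact (K₀ : Set ↥(unitaryGroupOfForm (conjLocal L (IsCMField.complexConj L) v) (cmLocalForm L 3 v))))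
    (hK₀o : IsOpen (K₀ : Set ↥(unitaryGroupOfForm (conjLocal L (IsCMField.complexConj L) v) (cmLocalForm L 3 v))))
    (hZK₀ : Subgroup.center ↥(unitaryGroupOfForm (conjLocal L (IsCMField.complexConj L) v) (cmLocalForm L 3 v)) ≤ K₀)
    (hKle : 𝓘.K 0 ≤ K₀)
    (haN : ∀ x ∈ 𝓘.K 0 ⊓ (cmBorelTriple L 3 v).N, 𝓘.a * x * 𝓘.a⁻¹ ∈ 𝓘.K 0)
    (haNbar : ∀ x ∈ 𝓘.K 0 ⊓ 𝓘.Nbar, 𝓘.a⁻¹ * x * 𝓘.a ∈ 𝓘.K 0 ⊓ 𝓘.Nbar)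
    (hinj : ∀ nb ∈ 𝓘.Nbar, ∀ m ∈ (cmBorelTriple L 3 v).M, ∀ n ∈ (cmBorelTriple L 3 v).N, ∀ nb' ∈ 𝓘.Nbar, ∀ m' ∈ (cmBorelTriple L 3 v).M,
      ∀ n' ∈ (cmBorelTriple L 3 v).N, nb * m * n = nb' * m' * n' → n = n')
    (m : ℕ) :
    μZ ((QuotientGroup.mk : _ → ↥(unitaryGroupOfForm (conjLocal L (IsCMField.complexConj L) v) (cmLocalForm L 3 v)) ⧸
          Subgroup.center ↥(unitaryGroupOfForm (conjLocal L (IsCMField.complexConj L) v) (cmLocalForm L 3 v))) ''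
        ((K₀ : Set _) * {𝓘.a ^ m} * (K₀ : Set _))) ≤
      ENNReal.ofReal ((((𝓘.K 0).relIndex K₀ : ℝ) *
          μZ.real ((QuotientGroup.mk : _ → ↥(unitaryGroupOfForm (conjLocal L (IsCMField.complexConj L) v) (cmLocalForm L 3 v)) ⧸
            Subgroup.center ↥(unitaryGroupOfForm (conjLocal L (IsCMField.complexConj L) v) (cmLocalForm L 3 v))) '' (K₀ : Set _))) *
        ((((haveI := locallyCompactSpace_cmBorelU L 3 v;
            (modularCharacter (⟨𝓘.a, (cmBorelTriple L 3 v).M_le 𝓘.a_mem⟩ : ↥(cmBorelTriple L 3 v).P) : ℝ≥0)) : ℝ)⁻¹) ^ m)) := by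
  haveI := locallyCompactSpace_cmBorelU L 3 v
  haveI : LocallyCompactSpace ↥(unitaryGroupOfForm (conjLocal L (IsCMField.complexConj L) v) (cmLocalForm L 3 v)) :=
    locallyCompactSpace_local (IsCMField.complexConj L) 3 _ v
  haveI : SecondCountableTopology ↥(unitaryGroupOfForm (conjLocal L (IsCMField.complexConj L) v) (cmLocalForm L 3 v)) :=
    secondCountableTopology_local (IsCMField.complexConj L) 3 _ v
  have hNcl := isClosed_cmBorelTriple_N L v
  haveI : LocallyCompactSpace ↥(cmBorelTriple L 3 v).N := hNcl.isClosedEmbedding_subtypeVal.locallyCompactSpace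
  haveI : SecondCountableTopology ↥(cmBorelTriple L 3 v).N := TopologicalSpace.Subtype.secondCountableTopology _
  letI : MeasurableSpace ↥(cmBorelTriple L 3 v).N := borel _
  haveI : BorelSpace ↥(cmBorelTriple L 3 v).N := ⟨rfl⟩
  letI : MeasurableSpace ↥(unitaryGroupOfForm (conjLocal L (IsCMField.complexConj L) v) (cmLocalForm L 3 v)) := borel _
  haveI : BorelSpace ↥(unitaryGroupOfForm (conjLocal L (IsCMField.complexConj L) v) (cmLocalForm L 3 v)) := ⟨rfl⟩
  have hnorm : ∀ (s : ↥(torusU (conjLocal L (IsCMField.complexConj L) v) (cmLocalForm L 3 v))) (n), n ∈ (cmBorelTriple L 3 v).N →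
      (s : ↥(unitaryGroupOfForm (conjLocal L (IsCMField.complexConj L) v) (cmLocalForm L 3 v)))⁻¹ * n * s ∈ (cmBorelTriple L 3 v).N := by
    intro s n hn
    exact (HeisRing.torusConj (conjLocal L (IsCMField.complexConj L) v) s ⟨n, hn⟩).2
  have haN_ : ∀ n ∈ (cmBorelTriple L 3 v).N, 𝓘.a⁻¹ * n * 𝓘.a ∈ (cmBorelTriple L 3 v).N := fun n hn => hnorm ⟨𝓘.a, 𝓘.a_mem⟩ n hn
  have haN' : ∀ n ∈ (cmBorelTriple L 3 v).N, 𝓘.a * n * 𝓘.a⁻¹ ∈ (cmBorelTriple L 3 v).N := by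
    intro n hn
    have h := hnorm (⟨𝓘.a, 𝓘.a_mem⟩ : ↥(torusU (conjLocal L (IsCMField.complexConj L) v) (cmLocalForm L 3 v)))⁻¹ n hn
    rwa [Subgroup.coe_inv, inv_inv] at h
  have haM : ∀ x ∈ 𝓘.K 0 ⊓ (cmBorelTriple L 3 v).M, x * 𝓘.a = 𝓘.a * x := fun x hx => 𝓘.a_comm x (Subgroup.mem_inf.1 hx).2
  exact DoubleCosetIndex.measure_image_doubleCoset_pow_le_ofReal hZK₀ hK₀o hK₀c hKle (𝓘.isOpen_K 0) (𝓘.isCompact_K 0)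
    (𝓘.factorization 0) hinj haM haN haNbar haN_ haN' hNcl (Measure.haar : Measure ↥(cmBorelTriple L 3 v).N)
    (fun m => HeisRing.torusConj (conjLocal L (IsCMField.complexConj L) v)
      ((⟨𝓘.a, 𝓘.a_mem⟩ : ↥(torusU (conjLocal L (IsCMField.complexConj L) v) (cmLocalForm L 3 v))) ^ m)⁻¹)
    (coe_torusConj_pow_inv L v ⟨𝓘.a, 𝓘.a_mem⟩) (map_torusConj_pow_inv_cmBorel L v ⟨𝓘.a, 𝓘.a_mem⟩ _) μZ m

variable (w : PlacesOver L v) (hw : IsCMField.complexConj L • w.1 = w.1)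

include hw in
/-- **The square of the uniformiser ray, on the CM carrier**: if `a ∈ T(L⁺_v)` is the twisted ray `e a = d(ϖ, 1, (σ_w ϖ)⁻¹)` of the one-place
model, then `a² = b · k` in `T` with `e b = d(ϖσ_wϖ, 1, (σ_w(ϖσ_wϖ))⁻¹)` (an ADMISSIBLE torus element: `β = ϖ σ_w ϖ` is `σ_w`-fixed) and `e k`
INTEGRAL (★ `exists_sq_eq_admissible_mul_unit` pulled back along ★ `localNonsplitEquiv`, ★ `localNonsplitEquiv_mem_torusU_iff`).
[cite: Casselman1995, Thm. 4.4.6 p. 45] [cite: Rogawski1990, §1.10 p. 9] -/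
theorem exists_sq_eq_mul_of_coe_localNonsplitEquiv_eq_diagonal {ϖ : w.1.adicCompletion L} (hϖ0 : ϖ ≠ 0) (a : ↥(cmBorelTriple L 3 v).M)
    (ha : (((localNonsplitEquiv (IsCMField.complexConj L) (Literature.NumberTheory.Rogawski1990.qsForm L) (IsCMField.complexConj_ne_one L) w hw
          (a : ↥(unitaryGroupOfForm (conjLocal L (IsCMField.complexConj L) v) (cmLocalForm L 3 v))) :
        ↥(unitaryGroupOfForm (galAdicCompletionMap (L := L) (IsCMField.complexConj L) hw) (placeForm (Literature.NumberTheory.Rogawski1990.qsForm L) w.1))) :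
          GL (Fin 3) (w.1.adicCompletion L)) : Matrix (Fin 3) (Fin 3) (w.1.adicCompletion L)) =
      Matrix.diagonal ![ϖ, 1, ((galAdicCompletionMap (L := L) (IsCMField.complexConj L) hw) ϖ)⁻¹]) :
    ∃ b k : ↥(cmBorelTriple L 3 v).M, a ^ 2 = b * k ∧
      (((localNonsplitEquiv (IsCMField.complexConj L) (Literature.NumberTheory.Rogawski1990.qsForm L) (IsCMField.complexConj_ne_one L) w hw
          (b : ↥(unitaryGroupOfForm (conjLocal L (IsCMField.complexConj L) v) (cmLocalForm L 3 v))) :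
        ↥(unitaryGroupOfForm (galAdicCompletionMap (L := L) (IsCMField.complexConj L) hw) (placeForm (Literature.NumberTheory.Rogawski1990.qsForm L) w.1))) :
          GL (Fin 3) (w.1.adicCompletion L)) : Matrix (Fin 3) (Fin 3) (w.1.adicCompletion L)) =
        Matrix.diagonal ![ϖ * galAdicCompletionMap (L := L) (IsCMField.complexConj L) hw ϖ, 1,
          (galAdicCompletionMap (L := L) (IsCMField.complexConj L) hw (ϖ * galAdicCompletionMap (L := L) (IsCMField.complexConj L) hw ϖ))⁻¹] ∧
      ((localNonsplitEquiv (IsCMField.complexConj L) (Literature.NumberTheory.Rogawski1990.qsForm L) (IsCMField.complexConj_ne_one L) w hw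
          (k : ↥(unitaryGroupOfForm (conjLocal L (IsCMField.complexConj L) v) (cmLocalForm L 3 v))) :
        ↥(unitaryGroupOfForm (galAdicCompletionMap (L := L) (IsCMField.complexConj L) hw) (placeForm (Literature.NumberTheory.Rogawski1990.qsForm L) w.1))) :
          GL (Fin 3) (w.1.adicCompletion L)) ∈ glInt 3 (w.1.adicCompletion L) := by
  have hJw : placeForm (Literature.NumberTheory.Rogawski1990.qsForm L) w.1 = (StdForm.antidiagonal 3).over (w.1.adicCompletion L) := by
    rw [placeForm, Literature.NumberTheory.Rogawski1990.qsForm, antidiagOne_eq_over, StdForm.over_map]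
  have hσσ : ∀ x, galAdicCompletionMap (L := L) (IsCMField.complexConj L) hw
      (galAdicCompletionMap (L := L) (IsCMField.complexConj L) hw x) = x :=
    galAdicCompletionMap_galAdicCompletionMap_of_smul_eq (IsCMField.complexConj L) w (IsCMField.complexConj_ne_one L) hw
  have hσv : ∀ x, Valued.v ((galAdicCompletionMap (L := L) (IsCMField.complexConj L) hw) x) = Valued.v x :=
    fun x => valued_galAdicCompletionMap (L := L) (IsCMField.complexConj L) hw x
  obtain ⟨b, k, hbT, hkT, hb, hk, hsq⟩ := exists_sq_eq_admissible_mul_unit (galAdicCompletionMap (L := L) (IsCMField.complexConj L) hw) hJw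
    hσσ hσv hϖ0 _ ha
  have hbM : (localNonsplitEquiv (IsCMField.complexConj L) (Literature.NumberTheory.Rogawski1990.qsForm L) (IsCMField.complexConj_ne_one L) w hw).symm b ∈
      (cmBorelTriple L 3 v).M :=
    (localNonsplitEquiv_mem_torusU_iff L v w hw _).1 (by rwa [ContinuousMulEquiv.apply_symm_apply])
  have hkM : (localNonsplitEquiv (IsCMField.complexConj L) (Literature.NumberTheory.Rogawski1990.qsForm L) (IsCMField.complexConj_ne_one L) w hw).symm k ∈
      (cmBorelTriple L 3 v).M :=
    (localNonsplitEquiv_mem_torusU_iff L v w hw _).1 (by rwa [ContinuousMulEquiv.apply_symm_apply])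
  refine ⟨⟨_, hbM⟩, ⟨_, hkM⟩, ?_, ?_, ?_⟩
  · have h2 := congrArg (localNonsplitEquiv (IsCMField.complexConj L) (Literature.NumberTheory.Rogawski1990.qsForm L)
      (IsCMField.complexConj_ne_one L) w hw).symm hsq
    rw [map_pow, map_mul, ContinuousMulEquiv.symm_apply_apply] at h2
    exact Subtype.ext h2
  · rw [ContinuousMulEquiv.apply_symm_apply]
    exact hb
  · rw [ContinuousMulEquiv.apply_symm_apply]
    exact hk

end UnitaryGroup

end Literature.NumberTheory.Automorphic

end
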